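import Summits.CriticalPhenomena.PercolationContinuityZ3.Theorems.PercNearOneGluingNoHeavyQuantOneBig
import Summits.CriticalPhenomena.PercolationContinuityZ3.Theorems.PercNearOneGluingNoHeavyQuantFarTreeLevelBounds
import HarnessLib

/-!
# QUANT lane R8, Conjecture DIB\* — CELL F1 IS A THEOREM: `OneBigCert` holds, hence DIB\* for every system with exactly one blob of size `> j/2`

builds on p205010 (kernel theorem, internal audit signed; external expert review pending)

Support file (`--supports stmt-CriticalPhenomena-4575`), QUANT lane lead (gen 19); memo
`run/shared/lean/prim/quant/prim-quant-lead-g19/LEAD-NOTES-G19.md` N37–N38, spec `prim-quant-lead-g19/FOR-PROVERS-F1.md`.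
Theorems only; no sorries, standard axioms.  Companion of `…QuantOneBig` (p272761: `@[conjecture] IndepBlob.OneBigCert` and the kernel
reduction `RootDec.oneBig_row_of_cert`).

THE PROOF OF `OneBigCert` (N38).  The menu is used as follows: Cantelli at the help level `ℓ = j − b` ALWAYS; at level `j` (the cloud alone)
Markov on the closed mass when `C := 2j − bφ ≤ (1+x)j` (`αφ ≥ 1 − x`, `α = b/j`), Cantelli otherwise.  The cloud's aggregates are
eliminated by two monotonicity chains: `cant_chain` (the Cantelli bound `k(2m−C)/(k(2m−C) + (m−ℓ)²)`, `k = j(1−x)/2`, is worst at the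
smallest admissible mean `m = C`: identity `C(m−ℓ)² − (2m−C)(C−ℓ)² = (m−C)(Cm − (C−ℓ)² − ℓ²)`) and `markov_chain` (`E/(A−j)` with
`E ≤ A − C`, `E ≤ (1−x)((1+x)A − C)` is worst at `A = C/x`: `(C−j)(xA−C) ≤ 0` resp. `(C−(1+x)j)(xA−C) ≤ 0`).  What remains are FOUR
polynomial inequalities in three variables (`y = 1−x ∈ [0,½]`, `α ∈ [½,1]`, and `q = 1−p ∈ [0,y]` for a heavy big resp. `d = 1−φ ∈ [y,1]` for a
light one), each closed by `linarith` with a HANDELMAN certificate (products of the box/region constraints; supports found by LP, kit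
j132513/j132519: 31 / 36 / 47 / 57 products, degrees 7 / 4 / 5 / 5): `hm_poly`, `hc_poly`, `lm_poly`, `lc_poly`.

* `Quant.IndepBlob.OneBigIneq.hm_poly` / `hc_poly` / `lm_poly` / `lc_poly` — the four certificates.
* `Quant.IndepBlob.OneBigIneq.cant_chain`, `markov_chain`, `combine`, `level_bound`, `final_M`, `final_C` — the chains.
* **`Quant.IndepBlob.oneBigCert_holds : OneBigCert`.**
* **`Quant.RootDec.tail_ge_of_oneBig`** — DIB\* (floor `1/2 ≤ x < 1`, gates `≥ x²`, credit `> 2j`) for EVERY system with exactly one blob of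
  size `> j/2` (the big of size `≤ j`, all other blobs of size `≤ j/2`): `oneBig_row_of_cert oneBigCert_holds`.  This is CELL F1 of the
  residual class of T-DIB (README V227/V228) — the cell that carries all the worst cases found by the lane's censuses.
[this work]; the gluing rows served [cite: KozmaNitzan2024, Conjecture 3 (p. 15)]; product weights [cite: Grimmett1999, §1.3 p. 10].
-/

namespace Summit.CriticalPhenomena.PercolationContinuityZ3.Theorems
namespace Quant
namespace IndepBlob
namespace OneBigIneq

/-- Heavy big, Markov at level `j` (cell HM): in closure coordinates `y = 1 − x ∈ [0, 1/2]`, `q = 1 − p ∈ [0, y]`, `α = b/j ∈ [1/2, 1]`,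
with `C = 2 − α + αq`, `D₁ = C − x`, `D₂ = yC + 2(1 + αq)²`: `D₁D₂ − qC·D₂ − (1−q)C·D₁ ≥ 0` (degree-7 Handelman certificate, 31 products). [this work] -/
theorem hm_poly (y q a : ℝ) (hy : 0 ≤ y) (hy2 : 0 ≤ 1 / 2 - y) (hq : 0 ≤ q) (hqy : 0 ≤ y - q) (ha : 0 ≤ a - 1 / 2) (ha1 : 0 ≤ 1 - a) :
    0 ≤ (1 + y - a + a * q) * (y * (2 - a + a * q) + 2 * (1 + a * q) ^ 2) - q * (2 - a + a * q) * (y * (2 - a + a * q) + 2 * (1 + a * q) ^ 2) - (1 - q) * (2 - a + a * q) * (1 + y - a + a * q) := by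
  linarith [ha1, mul_nonneg ha ha1, hqy, mul_nonneg (mul_nonneg hqy ha1) ha1, mul_nonneg hq hqy, mul_nonneg (mul_nonneg (mul_nonneg hq hqy) ha) ha1, mul_nonneg (mul_nonneg (mul_nonneg (mul_nonneg hq hqy) hqy) ha) ha1, mul_nonneg (mul_nonneg (mul_nonneg (mul_nonneg hq hq) ha1) ha1) ha1, mul_nonneg (mul_nonneg hq hq) ha, mul_nonneg (mul_nonneg (mul_nonneg (mul_nonneg hq hq) ha) ha) ha1, mul_nonneg (mul_nonneg hq hq) hqy, mul_nonneg (mul_nonneg (mul_nonneg hq hq) hqy) ha, mul_nonneg (mul_nonneg (mul_nonneg (mul_nonneg hq hq) hqy) ha) ha, mul_nonneg (mul_nonneg (mul_nonneg (mul_nonneg (mul_nonneg hq hq) hq) ha) ha) ha, mul_nonneg (mul_nonneg (mul_nonneg hq hq) hq) hqy, mul_nonneg (mul_nonneg (mul_nonneg (mul_nonneg (mul_nonneg hq hq) hq) hqy) ha) ha, mul_nonneg (mul_nonneg (mul_nonneg (mul_nonneg (mul_nonneg (mul_nonneg hq hq) hq) hqy) ha) ha) ha, mul_nonneg (mul_nonneg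 (mul_nonneg (mul_nonneg hq hq) hq) hq) ha1, mul_nonneg (mul_nonneg hy2 hq) hq, mul_nonneg (mul_nonneg (mul_nonneg hy2 hq) hq) hq, mul_nonneg (mul_nonneg (mul_nonneg (mul_nonneg hy2 hq) hq) hq) ha, mul_nonneg (mul_nonneg (mul_nonneg (mul_nonneg (mul_nonneg hy2 hq) hq) hq) ha) ha, mul_nonneg (mul_nonneg (mul_nonneg (mul_nonneg (mul_nonneg (mul_nonneg hy2 hq) hq) hq) ha) ha) ha, mul_nonneg hy hqy, mul_nonneg (mul_nonneg hy hqy) ha1, mul_nonneg (mul_nonneg hy hq) ha, mul_nonneg (mul_nonneg hy hq) hqy, mul_nonneg (mul_nonneg (mul_nonneg hy hq) hqy) ha, mul_nonneg (mul_nonneg (mul_nonneg (mul_nonneg hy hq) hq) ha1) ha1, mul_nonneg (mul_nonneg (mul_nonneg (mul_nonneg hy hy2) hq) ha) ha1, mul_nonneg hy hy]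

/-- Heavy big, Cantelli at level `j` (cell HC), region `y ≥ α(1 − q)`: with `D₃ = yC + 2(C − 1)²`: `D₃D₂ − qC·D₂ − (1−q)C·D₃ ≥ 0`
(degree-4 certificate, 36 products). [this work] -/
theorem hc_poly (y q a : ℝ) (hy : 0 ≤ y) (hy2 : 0 ≤ 1 / 2 - y) (hq : 0 ≤ q) (hqy : 0 ≤ y - q) (ha : 0 ≤ a - 1 / 2) (ha1 : 0 ≤ 1 - a)
    (hreg : 0 ≤ y - a + a * q) :
    0 ≤ (y * (2 - a + a * q) + 2 * (1 - a + a * q) ^ 2) * (y * (2 - a + a * q) + 2 * (1 + a * q) ^ 2) - q * (2 - a + a * q) * (y * (2 - a + a * q) + 2 * (1 + a * q) ^ 2) - (1 - q) * (2 - a + a * q) * (y * (2 - a + a * q) + 2 * (1 - a + a * q) ^ 2) := by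
  linarith [hreg, mul_nonneg (mul_nonneg (mul_nonneg hreg hreg) hreg) hreg, ha1, mul_nonneg ha hreg, mul_nonneg (mul_nonneg ha hreg) hreg, mul_nonneg (mul_nonneg (mul_nonneg ha hreg) hreg) hreg, mul_nonneg (mul_nonneg (mul_nonneg ha ha) hreg) hreg, mul_nonneg (mul_nonneg hqy ha1) hreg, mul_nonneg (mul_nonneg (mul_nonneg hqy ha1) hreg) hreg, mul_nonneg (mul_nonneg hqy ha1) ha1, mul_nonneg (mul_nonneg (mul_nonneg hqy ha) ha1) hreg, mul_nonneg (mul_nonneg (mul_nonneg hqy hqy) ha1) ha1, mul_nonneg (mul_nonneg (mul_nonneg hqy hqy) ha) hreg, mul_nonneg (mul_nonneg (mul_nonneg hqy hqy) ha) ha, hq, mul_nonneg hq hreg, mul_nonneg (mul_nonneg hq ha) hreg, mul_nonneg hq hqy, mul_nonneg (mul_nonneg hq hq) hreg, mul_nonneg (mul_nonneg (mul_nonneg hq hq) ha) hreg, mul_nonneg (mul_nonneg (mul_nonneg hy2 hreg) hreg) hreg, mul_nonneg (mul_nonneg (mul_nonneg hy2 ha) hreg) hreg, mul_nonneg (mul_nonneg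 hy2 ha) ha1, mul_nonneg hy2 hqy, mul_nonneg (mul_nonneg (mul_nonneg hy2 hqy) ha1) hreg, mul_nonneg (mul_nonneg (mul_nonneg hy2 hq) ha1) ha1, mul_nonneg (mul_nonneg (mul_nonneg hy2 hy2) hreg) hreg, mul_nonneg (mul_nonneg (mul_nonneg hy2 hy2) ha) hreg, mul_nonneg (mul_nonneg (mul_nonneg hy2 hy2) hy2) ha, hy, mul_nonneg hy hreg, mul_nonneg (mul_nonneg (mul_nonneg hy hqy) ha1) ha1, mul_nonneg (mul_nonneg hy hq) ha, mul_nonneg (mul_nonneg (mul_nonneg hy hy) hreg) hreg, mul_nonneg (mul_nonneg (mul_nonneg hy hy) hy2) hreg, mul_nonneg (mul_nonneg (mul_nonneg hy hy) hy2) hy2]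

/-- Light big, Markov at level `j` (cell LM): `d = 1 − φ ∈ [y, 1]`, `q = y(1 − y + d)`, region `α(1 − d) ≥ y`; `C = 2 − α + αd`,
`D₁ = 1 + y − α + αd`, `D₂ = yC + 2(1 + αd)²`: `D₁D₂ − qC·D₂ − (1−q)C·D₁ ≥ 0` (degree-5 certificate, 47 products). [this work] -/
theorem lm_poly (y d a : ℝ) (hy : 0 ≤ y) (hy2 : 0 ≤ 1 / 2 - y) (hd : 0 ≤ d - y) (hd1 : 0 ≤ 1 - d) (ha : 0 ≤ a - 1 / 2) (ha1 : 0 ≤ 1 - a)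
    (hreg : 0 ≤ a - a * d - y) :
    0 ≤ (1 + y - a + a * d) * (y * (2 - a + a * d) + 2 * (1 + a * d) ^ 2) - (y * (1 - y + d)) * (2 - a + a * d) * (y * (2 - a + a * d) + 2 * (1 + a * d) ^ 2) - (1 - (y * (1 - y + d))) * (2 - a + a * d) * (1 + y - a + a * d) := by
  linarith [ha1, mul_nonneg ha1 hreg, mul_nonneg ha ha1, mul_nonneg hd1 ha1, mul_nonneg (mul_nonneg hd ha1) hreg, mul_nonneg (mul_nonneg (mul_nonneg hd hd1) ha1) hreg, mul_nonneg (mul_nonneg (mul_nonneg (mul_nonneg hd hd1) hd1) hd1) ha1, mul_nonneg hd hd, mul_nonneg (mul_nonneg hd hd) hreg, mul_nonneg (mul_nonneg hd hd) ha, mul_nonneg (mul_nonneg (mul_nonneg (mul_nonneg hd hd) ha) ha1) hreg, mul_nonneg (mul_nonneg hd hd) hd, mul_nonneg (mul_nonneg (mul_nonneg hd hd) hd) hreg, mul_nonneg (mul_nonneg (mul_nonneg hd hd) hd) ha, mul_nonneg (mul_nonneg (mul_nonneg (mul_nonneg hd hd) hd) ha) ha, mul_nonneg (mul_nonneg (mul_nonneg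 hd hd) hd) hd, mul_nonneg (mul_nonneg hy2 ha) ha1, mul_nonneg (mul_nonneg (mul_nonneg (mul_nonneg hy2 hd) hd1) ha) ha1, mul_nonneg (mul_nonneg hy2 hd) hd, mul_nonneg (mul_nonneg (mul_nonneg (mul_nonneg hy2 hd) hd) hd) ha, mul_nonneg (mul_nonneg (mul_nonneg (mul_nonneg hy2 hy2) hd) hreg) hreg, mul_nonneg (mul_nonneg (mul_nonneg (mul_nonneg hy2 hy2) hd) hd) ha, mul_nonneg (mul_nonneg (mul_nonneg (mul_nonneg hy2 hy2) hy2) ha) ha1, mul_nonneg (mul_nonneg (mul_nonneg hy hd1) ha1) hreg, mul_nonneg (mul_nonneg hy hd) hreg, mul_nonneg (mul_nonneg (mul_nonneg (mul_nonneg hy hd) hreg) hreg) hreg, mul_nonneg (mul_nonneg (mul_nonneg (mul_nonneg hy hd) ha1) hreg) hreg, mul_nonneg (mul_nonneg (mul_nonneg hy hd) ha) hreg, mul_nonneg (mul_nonneg hy hd) hd1, mul_nonneg (mul_nonneg (mul_nonneg hy hd) hd) hreg, mul_nonneg (mul_nonneg (mul_nonneg (mul_nonneg hy hd) hd) ha)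 hreg, mul_nonneg (mul_nonneg (mul_nonneg (mul_nonneg hy hy2) hy2) ha1) hreg, mul_nonneg (mul_nonneg (mul_nonneg (mul_nonneg hy hy2) hy2) hd) ha1, mul_nonneg hy hy, mul_nonneg (mul_nonneg hy hy) hreg, mul_nonneg (mul_nonneg (mul_nonneg (mul_nonneg hy hy) ha1) hreg) hreg, mul_nonneg (mul_nonneg hy hy) ha, mul_nonneg (mul_nonneg (mul_nonneg (mul_nonneg hy hy) hd1) hd1) ha1, mul_nonneg (mul_nonneg (mul_nonneg hy hy) hd) hreg, mul_nonneg (mul_nonneg (mul_nonneg (mul_nonneg hy hy) hd) hreg) hreg, mul_nonneg (mul_nonneg (mul_nonneg (mul_nonneg hy hy) hd) ha) ha1, mul_nonneg (mul_nonneg (mul_nonneg (mul_nonneg hy hy) hy2) hy2) hd, mul_nonneg (mul_nonneg (mul_nonneg hy hy) hy) hreg, mul_nonneg (mul_nonneg (mul_nonneg (mul_nonneg hy hy) hy) ha) ha, mul_nonneg (mul_nonneg (mul_nonneg (mul_nonneg hy hy) hy) hd1) ha, mul_nonneg (mul_nonneg (mul_nonneg (mul_nonneg hy hy) hy) hd)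 hreg, mul_nonneg (mul_nonneg (mul_nonneg (mul_nonneg hy hy) hy) hy) hd]

/-- Light big, Cantelli at level `j` (cell LC), region `y ≥ α(1 − d)`: `D₃D₂ − qC·D₂ − (1−q)C·D₃ ≥ 0` with `D₃ = yC + 2(1 − α + αd)²`
(degree-5 certificate, 57 products). [this work] -/
theorem lc_poly (y d a : ℝ) (hy : 0 ≤ y) (hy2 : 0 ≤ 1 / 2 - y) (hd : 0 ≤ d - y) (hd1 : 0 ≤ 1 - d) (ha : 0 ≤ a - 1 / 2) (ha1 : 0 ≤ 1 - a)
    (hreg : 0 ≤ y - a + a * d) :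
    0 ≤ (y * (2 - a + a * d) + 2 * (1 - a + a * d) ^ 2) * (y * (2 - a + a * d) + 2 * (1 + a * d) ^ 2) - (y * (1 - y + d)) * (2 - a + a * d) * (y * (2 - a + a * d) + 2 * (1 + a * d) ^ 2) - (1 - (y * (1 - y + d))) * (2 - a + a * d) * (y * (2 - a + a * d) + 2 * (1 - a + a * d) ^ 2) := by
  linarith [hreg, mul_nonneg hreg hreg, mul_nonneg (mul_nonneg hreg hreg) hreg, mul_nonneg (mul_nonneg (mul_nonneg hreg hreg) hreg) hreg, mul_nonneg ha hreg, mul_nonneg (mul_nonneg ha hreg) hreg, mul_nonneg (mul_nonneg (mul_nonneg ha hreg) hreg) hreg, mul_nonneg ha ha1, mul_nonneg (mul_nonneg ha ha) hreg, mul_nonneg (mul_nonneg (mul_nonneg ha ha) hreg) hreg, mul_nonneg (mul_nonneg (mul_nonneg (mul_nonneg hd1 ha1) hreg) hreg) hreg, mul_nonneg hd1 hd1, mul_nonneg (mul_nonneg (mul_nonneg (mul_nonneg hd1 hd1) ha1) hreg) hreg, mul_nonneg (mul_nonneg (mul_nonneg (mul_nonneg hd1 hd1) hd1) ha1) ha1,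 mul_nonneg (mul_nonneg (mul_nonneg hd1 hd1) hd1) hd1, hd, mul_nonneg hd hreg, mul_nonneg (mul_nonneg hd hreg) hreg, mul_nonneg (mul_nonneg (mul_nonneg hd hreg) hreg) hreg, mul_nonneg hd ha, mul_nonneg (mul_nonneg hd ha) hreg, mul_nonneg (mul_nonneg (mul_nonneg hd ha) hreg) hreg, mul_nonneg (mul_nonneg (mul_nonneg hd ha) ha) hreg, mul_nonneg (mul_nonneg (mul_nonneg (mul_nonneg hd ha) ha) hreg) hreg, mul_nonneg (mul_nonneg (mul_nonneg hd hd1) ha) ha1, mul_nonneg hd hd, mul_nonneg (mul_nonneg hd hd) hreg, mul_nonneg (mul_nonneg hd hd) ha, mul_nonneg (mul_nonneg (mul_nonneg hd hd) ha) hreg, mul_nonneg (mul_nonneg (mul_nonneg (mul_nonneg hd hd) ha) hreg) hreg, mul_nonneg (mul_nonneg (mul_nonneg (mul_nonneg hd hd) ha) ha) hreg, mul_nonneg (mul_nonneg hd hd) hd, mul_nonneg (mul_nonneg (mul_nonneg hd hd) hd) ha, mul_nonneg (mul_nonneg (mul_nonneg (mul_nonneg hd hd) hd) ha) hreg, mul_nonneg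 (mul_nonneg (mul_nonneg (mul_nonneg hd hd) hd) ha) ha, mul_nonneg (mul_nonneg (mul_nonneg hd hd) hd) hd, mul_nonneg (mul_nonneg (mul_nonneg (mul_nonneg hd hd) hd) hd) ha, mul_nonneg (mul_nonneg hy2 ha) ha1, mul_nonneg (mul_nonneg (mul_nonneg (mul_nonneg hy2 hd1) ha1) hreg) hreg, mul_nonneg (mul_nonneg (mul_nonneg (mul_nonneg hy2 hd1) ha) ha1) ha1, mul_nonneg (mul_nonneg (mul_nonneg (mul_nonneg hy2 hd1) hd1) ha1) hreg, mul_nonneg (mul_nonneg (mul_nonneg (mul_nonneg hy2 hd) hd) ha) hreg, mul_nonneg (mul_nonneg (mul_nonneg (mul_nonneg hy2 hy2) ha) ha1) hreg, mul_nonneg (mul_nonneg (mul_nonneg (mul_nonneg hy2 hy2) hd) ha) hreg, mul_nonneg (mul_nonneg (mul_nonneg (mul_nonneg hy2 hy2) hd) hd) ha, mul_nonneg (mul_nonneg (mul_nonneg (mul_nonneg hy2 hy2) hy2) ha) ha1, mul_nonneg (mul_nonneg (mul_nonneg (mul_nonneg hy2 hy2) hy2) hd) ha, hy, mul_nonneg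 (mul_nonneg (mul_nonneg (mul_nonneg hy ha1) ha1) hreg) hreg, mul_nonneg (mul_nonneg (mul_nonneg (mul_nonneg hy hd1) ha1) ha1) ha1, mul_nonneg (mul_nonneg (mul_nonneg (mul_nonneg hy hy2) ha1) ha1) hreg, mul_nonneg (mul_nonneg (mul_nonneg (mul_nonneg hy hy2) hd) hd) ha1, mul_nonneg (mul_nonneg (mul_nonneg (mul_nonneg hy hy) ha1) hreg) hreg, mul_nonneg (mul_nonneg (mul_nonneg (mul_nonneg hy hy) hd1) ha1) hreg, mul_nonneg (mul_nonneg (mul_nonneg (mul_nonneg hy hy) hd) hd) ha, mul_nonneg (mul_nonneg (mul_nonneg (mul_nonneg hy hy) hy2) hd1) ha1, mul_nonneg (mul_nonneg (mul_nonneg (mul_nonneg hy hy) hy) ha) ha]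


/-! ### Real-analytic chain lemmas -/

/-- The Cantelli chain: for `0 < k`, `0 ≤ ℓ ≤ C ≤ m`, `0 < C`:
`k(2m − C)/(k(2m − C) + (m − ℓ)²) ≤ kC/(kC + (C − ℓ)²)` (worst at the smallest mean `m = C`; identity
`C(m−ℓ)² − (2m−C)(C−ℓ)² = (m − C)(Cm − (C−ℓ)² − ℓ²)`). [this work] -/
theorem cant_chain (k C m l : ℝ) (hk : 0 < k) (hl : 0 ≤ l) (hlC : l ≤ C) (hCm : C ≤ m) (hC : 0 < C) :
    k * (2 * m - C) / (k * (2 * m - C) + (m - l) ^ 2) ≤ k * C / (k * C + (C - l) ^ 2) := by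
  have h1 : 0 < k * (2 * m - C) + (m - l) ^ 2 := by nlinarith [sq_nonneg (m - l)]
  have h2 : 0 < k * C + (C - l) ^ 2 := by nlinarith [sq_nonneg (C - l)]
  rw [div_le_div_iff₀ h1 h2]
  have key : 0 ≤ (m - C) * (C * m - (C - l) ^ 2 - l ^ 2) :=
    mul_nonneg (by linarith) (by nlinarith [mul_nonneg hl (sub_nonneg.2 hlC), mul_le_mul_of_nonneg_left hCm hC.le])
  have e : k * C * (k * (2 * m - C) + (m - l) ^ 2) - k * (2 * m - C) * (k * C + (C - l) ^ 2) =
      k * ((m - C) * (C * m - (C - l) ^ 2 - l ^ 2)) := by ring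
  nlinarith [mul_nonneg hk.le key]

/-- The Markov chain: `E ≤ A − C`, `E ≤ (1−x)((1+x)A − C)`, `j ≤ C ≤ (1+x)j`, `j < A` ⟹ `E/(A − j) ≤ (1 − x)·C/(C − x·j)` (worst at
`A = C/x`). [this work] -/
theorem markov_chain (x A C j E : ℝ) (hx1 : x < 1) (hjA : j < A) (hjC : j ≤ C) (hCj : C ≤ (1 + x) * j) (hj0 : 0 < j)
    (hE1 : E ≤ A - C) (hE2 : E ≤ (1 - x) * ((1 + x) * A - C)) :
    E / (A - j) ≤ (1 - x) * C / (C - x * j) := by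
  have hCx : 0 < C - x * j := by nlinarith
  have hAj : 0 < A - j := by linarith
  rw [div_le_div_iff₀ hAj hCx]
  by_cases hcase : x * A ≤ C
  · have key : 0 ≤ (C - j) * (C - x * A) := mul_nonneg (by linarith) (by linarith)
    nlinarith [mul_le_mul_of_nonneg_right hE1 hCx.le]
  · have key : 0 ≤ ((1 + x) * j - C) * (x * A - C) := mul_nonneg (by linarith) (by linarith [not_le.1 hcase])
    nlinarith [mul_le_mul_of_nonneg_right hE2 hCx.le]

/-- From a polynomial certificate `0 ≤ D₁D₂ − qC·D₂ − (1−q)C·D₁` with `D₁, D₂ > 0`, `0 ≤ q ≤ 1`, `C ≥ 0` and bounds `T₁ ≤ y·C/D₁`,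
`T₂ ≤ y·C/D₂` (`y ≥ 0`): `(1−q)·T₂ + q·T₁ ≤ y`. [this work] -/
theorem combine {q C D₁ D₂ T₁ T₂ y : ℝ} (hD₁ : 0 < D₁) (hD₂ : 0 < D₂) (hq0 : 0 ≤ q) (hq1 : q ≤ 1) (hy : 0 ≤ y)
    (h : 0 ≤ D₁ * D₂ - q * C * D₂ - (1 - q) * C * D₁) (hT₁ : T₁ ≤ y * C / D₁) (hT₂ : T₂ ≤ y * C / D₂) :
    (1 - q) * T₂ + q * T₁ ≤ y := by
  have h1 : q * (y * C / D₁) + (1 - q) * (y * C / D₂) ≤ y := by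
    rw [mul_div_assoc', mul_div_assoc', div_add_div _ _ hD₁.ne' hD₂.ne', div_le_iff₀ (mul_pos hD₁ hD₂)]
    nlinarith [mul_nonneg hy h]
  nlinarith [mul_le_mul_of_nonneg_left hT₁ hq0, mul_le_mul_of_nonneg_left hT₂ (sub_nonneg.2 hq1)]

/-- REGION M (`αφ ≥ 1 − x`): the Markov bound at level `j` and the Cantelli bound at level `ℓ`, in normalised form, imply
`p·T₂ + (1−p)·T₁ ≤ 1 − x` (heavy via `hm_poly`, light via `lm_poly`). [this work] -/
theorem final_M (x p a φ T₁ T₂ : ℝ) (hx : 1 / 2 ≤ x) (hx1 : x < 1) (hp : x ^ 2 ≤ p) (hp1 : p ≤ 1)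
    (ha : 0 ≤ a - 1 / 2) (ha1 : 0 ≤ 1 - a) (hφ : (if x ≤ p then p else (p - x ^ 2) / (1 - x)) = φ)
    (hreg : 0 ≤ a * φ - (1 - x))
    (hT₁ : T₁ ≤ (1 - x) * (2 - a * φ) / ((2 - a * φ) - x))
    (hT₂ : T₂ ≤ (1 - x) * (2 - a * φ) / ((1 - x) * (2 - a * φ) + 2 * (1 + a * (1 - φ)) ^ 2)) :
    p * T₂ + (1 - p) * T₁ ≤ 1 - x := by
  have hy0 : 0 < 1 - x := by linarith
  by_cases hxp : x ≤ p
  · rw [if_pos hxp] at hφ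
    subst hφ
    have poly := hm_poly (1 - x) (1 - p) a (by linarith) (by linarith) (by linarith) (by linarith) ha ha1
    have hD₁ : 0 < 1 + (1 - x) - a + a * (1 - p) := by nlinarith
    have hD₂ : 0 < (1 - x) * (2 - a + a * (1 - p)) + 2 * (1 + a * (1 - p)) ^ 2 := by nlinarith [sq_nonneg (1 + a * (1 - p))]
    have e1 : (2 - a * p) - x = 1 + (1 - x) - a + a * (1 - p) := by ring
    have e2 : (2 - a * p) = 2 - a + a * (1 - p) := by ring
    rw [e1, e2] at hT₁
    rw [e2] at hT₂
    have := combine hD₁ hD₂ (by linarith : (0:ℝ) ≤ 1 - p) (by linarith) hy0.le poly hT₁ hT₂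
    have e3 : (1 : ℝ) - (1 - p) = p := by ring
    rw [e3] at this
    exact this
  · rw [if_neg hxp] at hφ
    have hpx : p < x := not_le.1 hxp
    -- d = 1 − φ, q = 1 − p = (1−x)(1 − (1−x) + d)
    have hφx : φ ≤ x := by rw [← hφ, div_le_iff₀ hy0]; nlinarith
    have hφ0 : 0 ≤ φ := by rw [← hφ]; exact div_nonneg (by linarith) hy0.le
    have hd_lo : 0 ≤ (1 - φ) - (1 - x) := by linarith
    have hd_hi : 0 ≤ 1 - (1 - φ) := by linarith
    have hq : 1 - p = (1 - x) * (1 - (1 - x) + (1 - φ)) := by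
      rw [← hφ]; field_simp; ring
    have poly := lm_poly (1 - x) (1 - φ) a (by linarith) (by linarith) hd_lo hd_hi ha ha1 (by linarith)
    rw [← hq] at poly
    have hD₁ : 0 < 1 + (1 - x) - a + a * (1 - φ) := by nlinarith
    have hD₂ : 0 < (1 - x) * (2 - a + a * (1 - φ)) + 2 * (1 + a * (1 - φ)) ^ 2 := by nlinarith [sq_nonneg (1 + a * (1 - φ))]
    have e1 : (2 - a * φ) - x = 1 + (1 - x) - a + a * (1 - φ) := by ring
    have e2 : (2 - a * φ) = 2 - a + a * (1 - φ) := by ring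
    rw [e1, e2] at hT₁
    rw [e2] at hT₂
    have := combine hD₁ hD₂ (by linarith : (0:ℝ) ≤ 1 - p) (by nlinarith) hy0.le poly hT₁ hT₂
    have e3 : (1 : ℝ) - (1 - p) = p := by ring
    rw [e3] at this
    exact this

/-- REGION C (`αφ ≤ 1 − x`): Cantelli at both levels, normalised, imply `p·T₂ + (1−p)·T₁ ≤ 1 − x` (heavy via `hc_poly`, light via
`lc_poly`). [this work] -/
theorem final_C (x p a φ T₁ T₂ : ℝ) (hx : 1 / 2 ≤ x) (hx1 : x < 1) (hp : x ^ 2 ≤ p) (hp1 : p ≤ 1)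
    (ha : 0 ≤ a - 1 / 2) (ha1 : 0 ≤ 1 - a) (hφ : (if x ≤ p then p else (p - x ^ 2) / (1 - x)) = φ)
    (hreg : 0 ≤ (1 - x) - a * φ)
    (hT₁ : T₁ ≤ (1 - x) * (2 - a * φ) / ((1 - x) * (2 - a * φ) + 2 * ((2 - a * φ) - 1) ^ 2))
    (hT₂ : T₂ ≤ (1 - x) * (2 - a * φ) / ((1 - x) * (2 - a * φ) + 2 * (1 + a * (1 - φ)) ^ 2)) :
    p * T₂ + (1 - p) * T₁ ≤ 1 - x := by
  have hy0 : 0 < 1 - x := by linarith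
  by_cases hxp : x ≤ p
  · rw [if_pos hxp] at hφ
    subst hφ
    have poly := hc_poly (1 - x) (1 - p) a (by linarith) (by linarith) (by linarith) (by linarith) ha ha1 (by linarith)
    have hD₁ : 0 < (1 - x) * (2 - a + a * (1 - p)) + 2 * (1 - a + a * (1 - p)) ^ 2 := by nlinarith [sq_nonneg (1 - a + a * (1 - p))]
    have hD₂ : 0 < (1 - x) * (2 - a + a * (1 - p)) + 2 * (1 + a * (1 - p)) ^ 2 := by nlinarith [sq_nonneg (1 + a * (1 - p))]
    have e1 : (2 - a * p) - 1 = 1 - a + a * (1 - p) := by ring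
    have e2 : (2 - a * p) = 2 - a + a * (1 - p) := by ring
    rw [e1, e2] at hT₁
    rw [e2] at hT₂
    have := combine hD₁ hD₂ (by linarith : (0:ℝ) ≤ 1 - p) (by linarith) hy0.le poly hT₁ hT₂
    have e3 : (1 : ℝ) - (1 - p) = p := by ring
    rw [e3] at this
    exact this
  · rw [if_neg hxp] at hφ
    have hpx : p < x := not_le.1 hxp
    have hφx : φ ≤ x := by rw [← hφ, div_le_iff₀ hy0]; nlinarith
    have hφ0 : 0 ≤ φ := by rw [← hφ]; exact div_nonneg (by linarith) hy0.le
    have hd_lo : 0 ≤ (1 - φ) - (1 - x) := by linarith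
    have hd_hi : 0 ≤ 1 - (1 - φ) := by linarith
    have hq : 1 - p = (1 - x) * (1 - (1 - x) + (1 - φ)) := by
      rw [← hφ]; field_simp; ring
    have poly := lc_poly (1 - x) (1 - φ) a (by linarith) (by linarith) hd_lo hd_hi ha ha1 (by linarith)
    rw [← hq] at poly
    have hD₁ : 0 < (1 - x) * (2 - a + a * (1 - φ)) + 2 * (1 - a + a * (1 - φ)) ^ 2 := by nlinarith [sq_nonneg (1 - a + a * (1 - φ))]
    have hD₂ : 0 < (1 - x) * (2 - a + a * (1 - φ)) + 2 * (1 + a * (1 - φ)) ^ 2 := by nlinarith [sq_nonneg (1 + a * (1 - φ))]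
    have e1 : (2 - a * φ) - 1 = 1 - a + a * (1 - φ) := by ring
    have e2 : (2 - a * φ) = 2 - a + a * (1 - φ) := by ring
    rw [e1, e2] at hT₁
    rw [e2] at hT₂
    have := combine hD₁ hD₂ (by linarith : (0:ℝ) ≤ 1 - p) (by nlinarith) hy0.le poly hT₁ hT₂
    have e3 : (1 : ℝ) - (1 - p) = p := by ring
    rw [e3] at this
    exact this

/-- One level of the cloud: `0 ≤ V ≤ k(2m − C)`, `0 < k`, `0 ≤ ℓ ≤ C < m`, `0 < C`, and the normalised value `Y` of `kC/(kC + (C−ℓ)²)`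
⟹ the Cantelli fail bound `V/(V + (m − ℓ)²) ≤ Y`. [this work] -/
theorem level_bound (V k C m l Y : ℝ) (hV0 : 0 ≤ V) (hW : V ≤ k * (2 * m - C)) (hk : 0 < k) (hl : 0 ≤ l) (hlC : l ≤ C)
    (hCm : C < m) (hC : 0 < C) (he : k * C / (k * C + (C - l) ^ 2) = Y) : V / (V + (m - l) ^ 2) ≤ Y := by
  have hD : 0 < (m - l) ^ 2 := by
    have : 0 < m - l := by linarith
    positivity
  rw [← he]
  exact (cantelli_expr_mono hV0 hW hD).trans (cant_chain k C m l hk hl hlC hCm.le hC)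

/-- **THE F1 CERTIFICATE HOLDS.**  Menu: Cantelli at level `ℓ = j − b` always; at level `j` Markov on the closed mass when
`αφ ≥ 1 − x` (`C ≤ (1+x)j`), Cantelli otherwise; the cloud chains `markov_chain` / `cant_chain`; the polynomial step `final_M` / `final_C`.
[this work] -/
theorem oneBigCert_holds' : OneBigCert := by
  intro x p A m s2 V c j b n hx hx1 hp hp1 hjb hbj hcred hcm hclosed hmA hV0 hs20 hs2c _hs2m _hs2E hVj _hVl _hnj
  generalize hφ : (if x ≤ p then p else (p - x ^ 2) / (1 - x)) = φ at hcred
  -- positivity bookkeeping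
  have hx0 : 0 < x := by linarith
  have hy0 : 0 < 1 - x := by linarith
  have hb1 : 1 ≤ b := by omega
  have hj1 : 1 ≤ j := le_trans hb1 hbj
  have hjr0 : (0 : ℝ) < j := by exact_mod_cast (lt_of_lt_of_le Nat.zero_lt_one hj1)
  have hbr : (b : ℝ) ≤ j := by exact_mod_cast hbj
  have hjb' : (j : ℝ) < 2 * b := by exact_mod_cast hjb
  have hl : ((j - b : ℕ) : ℝ) = (j : ℝ) - b := Nat.cast_sub hbj
  have hb0 : (0 : ℝ) ≤ b := Nat.cast_nonneg b
  have hφ1 : φ ≤ 1 := by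
    rw [← hφ]; split_ifs with h
    · exact hp1
    · rw [div_le_one hy0]; nlinarith [not_le.1 h]
  have hφ0 : 0 ≤ φ := by
    rw [← hφ]; split_ifs with h
    · linarith
    · exact div_nonneg (by linarith) hy0.le
  -- α = b/j and the cloud's credit infimum C = 2j − bφ = j(2 − αφ)
  obtain ⟨α, hα⟩ : ∃ α : ℝ, α = (b : ℝ) / j := ⟨_, rfl⟩
  have hαb : α * j = b := by rw [hα]; field_simp
  have ha : 0 ≤ α - 1 / 2 := by rw [hα, sub_nonneg, div_le_div_iff₀ (by norm_num : (0:ℝ) < 2) hjr0]; linarith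
  have ha1 : 0 ≤ 1 - α := by rw [hα, sub_nonneg, div_le_one hjr0]; exact hbr
  have hα0 : 0 ≤ α := by linarith
  have hαφ1 : α * φ ≤ 1 := by
    calc α * φ ≤ 1 * 1 := mul_le_mul (by linarith) hφ1 hφ0 (by norm_num)
      _ = 1 := by norm_num
  obtain ⟨C, hC⟩ : ∃ C : ℝ, C = (j : ℝ) * (2 - α * φ) := ⟨_, rfl⟩
  have hCb : C = 2 * j - b * φ := by rw [hC, ← hαb]; ring
  have hCc : C < c := by rw [hCb]; linarith
  have hCj : (j : ℝ) ≤ C := by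
    have := mul_le_mul_of_nonneg_left (show (1:ℝ) ≤ 2 - α * φ by linarith) hjr0.le
    rw [hC]; linarith
  have hmC : C < m := hCc.trans_le hcm
  have hjm : (j : ℝ) < m := hCj.trans_lt hmC
  have hjA : (j : ℝ) < A := hjm.trans_le hmA
  have hC0 : 0 < C := hjr0.trans_le hCj
  have hlm : ((j - b : ℕ) : ℝ) < m := by rw [hl]; linarith
  -- the cloud: E ≤ A − C, E ≤ (1−x)((1+x)A − C), V ≤ (j/2)(1−x)(2m − C)
  have hE1 : A - m ≤ A - C := by linarith
  have hE2 : A - m ≤ (1 - x) * ((1 + x) * A - C) := by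
    have h1 := mul_le_mul_of_nonneg_left hCc.le hy0.le
    have e : (1 - x) * ((1 + x) * A - C) = A - x ^ 2 * A - (1 - x) * C := by ring
    rw [e]; linarith
  have hW : V ≤ ((j : ℝ) / 2 * (1 - x)) * (2 * m - C) := by
    have h1 : s2 ≤ (1 - x) * (2 * m - C) := hs2c.trans (mul_le_mul_of_nonneg_left (by linarith) hy0.le)
    have h2 := mul_le_mul_of_nonneg_left h1 (by positivity : (0 : ℝ) ≤ (j : ℝ) / 2)
    linarith
  have hk : 0 < (j : ℝ) / 2 * (1 - x) := by positivity
  have hj2 : (0 : ℝ) < (j : ℝ) ^ 2 := by positivity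
  -- Cantelli at level ℓ = j − b: T₂ bound
  have hct : 0 < 2 - α * φ := by linarith
  have hT2 : V / (V + (m - ((j - b : ℕ) : ℝ)) ^ 2) ≤
      (1 - x) * (2 - α * φ) / ((1 - x) * (2 - α * φ) + 2 * (1 + α * (1 - φ)) ^ 2) := by
    rw [hl]
    refine level_bound V ((j : ℝ) / 2 * (1 - x)) C m ((j : ℝ) - b) _ hV0 hW hk (by linarith) (by linarith) hmC hC0 ?_
    have eCl : C - ((j : ℝ) - b) = j * (1 + α * (1 - φ)) := by rw [hC, ← hαb]; ring
    have h1 : 0 < (j : ℝ) / 2 * (1 - x) * ((j : ℝ) * (2 - α * φ)) + ((j : ℝ) * (1 + α * (1 - φ))) ^ 2 :=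
      add_pos_of_pos_of_nonneg (mul_pos hk (mul_pos hjr0 hct)) (sq_nonneg _)
    have h2 : 0 < (1 - x) * (2 - α * φ) + 2 * (1 + α * (1 - φ)) ^ 2 :=
      add_pos_of_pos_of_nonneg (mul_pos hy0 hct) (by positivity)
    rw [eCl, hC, div_eq_div_iff h1.ne' h2.ne']
    ring
  have hp0 : 0 ≤ p := le_trans (sq_nonneg x) hp
  by_cases hreg : C ≤ (1 + x) * j
  · -- REGION M: Markov on the closed mass at level j
    have hT1 : (A - m) / (A - j) ≤ (1 - x) * (2 - α * φ) / ((2 - α * φ) - x) := by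
      have h := markov_chain x A C j (A - m) hx1 hjA hCj hreg hjr0 hE1 hE2
      have h1 : 0 < (j : ℝ) * (2 - α * φ) - x * j := by
        rw [show (j : ℝ) * (2 - α * φ) - x * j = (j : ℝ) * ((2 - α * φ) - x) from by ring]
        exact mul_pos hjr0 (by linarith)
      have h2 : 0 < (2 - α * φ) - x := by linarith
      have e : (1 - x) * C / (C - x * j) = (1 - x) * (2 - α * φ) / ((2 - α * φ) - x) := by
        rw [hC, div_eq_div_iff h1.ne' h2.ne']
        ring
      rwa [e] at h
    have hregn : 0 ≤ α * φ - (1 - x) := by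
      have h' : (j : ℝ) * (2 - α * φ) ≤ (j : ℝ) * (1 + x) := by rw [hC] at hreg; linarith
      have := le_of_mul_le_mul_left h' hjr0
      linarith
    have fin := final_M x p α φ ((A - m) / (A - j)) (V / (V + (m - ((j - b : ℕ) : ℝ)) ^ 2)) hx hx1 hp hp1 ha ha1 hφ hregn hT1 hT2
    refine ⟨1 - V / (V + (m - ((j - b : ℕ) : ℝ)) ^ 2), 1 - (A - m) / (A - j),
      Or.inr (Or.inr (Or.inl ⟨hlm, le_rfl⟩)), Or.inr (Or.inl ⟨hjA, le_rfl⟩), ?_⟩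
    linarith [fin]
  · -- REGION C: Cantelli at level j as well
    have hreg' : (1 + x) * j ≤ C := (not_le.1 hreg).le
    have hT1 : V / (V + (m - j) ^ 2) ≤
        (1 - x) * (2 - α * φ) / ((1 - x) * (2 - α * φ) + 2 * ((2 - α * φ) - 1) ^ 2) := by
      refine level_bound V ((j : ℝ) / 2 * (1 - x)) C m (j : ℝ) _ hV0 hW hk hjr0.le hCj hmC hC0 ?_
      have eCj : C - (j : ℝ) = j * ((2 - α * φ) - 1) := by rw [hC]; ring
      have h1 : 0 < (j : ℝ) / 2 * (1 - x) * ((j : ℝ) * (2 - α * φ)) + ((j : ℝ) * ((2 - α * φ) - 1)) ^ 2 :=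
        add_pos_of_pos_of_nonneg (mul_pos hk (mul_pos hjr0 hct)) (sq_nonneg _)
      have h2 : 0 < (1 - x) * (2 - α * φ) + 2 * ((2 - α * φ) - 1) ^ 2 :=
        add_pos_of_pos_of_nonneg (mul_pos hy0 hct) (by positivity)
      rw [eCj, hC, div_eq_div_iff h1.ne' h2.ne']
      ring
    have hregn : 0 ≤ (1 - x) - α * φ := by
      have h' : (j : ℝ) * (1 + x) ≤ (j : ℝ) * (2 - α * φ) := by rw [hC] at hreg'; linarith
      have := le_of_mul_le_mul_left h' hjr0
      linarith
    have fin := final_C x p α φ (V / (V + (m - j) ^ 2)) (V / (V + (m - ((j - b : ℕ) : ℝ)) ^ 2)) hx hx1 hp hp1 ha ha1 hφ hregn hT1 hT2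
    refine ⟨1 - V / (V + (m - ((j - b : ℕ) : ℝ)) ^ 2), 1 - V / (V + (m - j) ^ 2),
      Or.inr (Or.inr (Or.inl ⟨hlm, le_rfl⟩)), Or.inr (Or.inr ⟨hjm, le_rfl⟩), ?_⟩
    linarith [fin]

end OneBigIneq

/-- **`OneBigCert` HOLDS** (lead g19, N38). [this work] -/
theorem oneBigCert_holds : OneBigCert := OneBigIneq.oneBigCert_holds'

end IndepBlob

namespace RootDec

variable {κ : Type} [Fintype κ] [DecidableEq κ]

/-- **CELL F1 OF T-DIB IS A THEOREM: DIB\* for every system with exactly one blob of size `> j/2`.**  Floor `1/2 ≤ x < 1`, gates in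
`[x², 1]`, one blob `k` with `j < 2·a k`, `a k ≤ j`, every other blob of size `≤ j/2`, discounted credit `> 2j` ⟹ `x ≤ P(N ≥ j+1)`.
(`oneBig_row_of_cert oneBigCert_holds`.) [this work] -/
theorem tail_ge_of_oneBig (a : κ → ℕ) (g : κ → ℝ) (j : ℕ) (x : ℝ) (hx : 1 / 2 ≤ x) (hx1 : x < 1)
    (hg : ∀ i, 0 ≤ g i ∧ g i ≤ 1) (hjunk : ∀ i, x ^ 2 ≤ g i) (k : κ) (hbig : j < 2 * a k) (hkj : a k ≤ j)
    (hsmall : ∀ i, i ≠ k → 2 * a i ≤ j)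
    (hcredit : (2 * j : ℝ) < ∑ i, (a i : ℝ) * (if x ≤ g i then g i else (g i - x ^ 2) / (1 - x))) :
    x ≤ ∑ W : Finset κ, (∏ i, if i ∈ W then g i else 1 - g i) * (if j + 1 ≤ ∑ i ∈ W, a i then (1 : ℝ) else 0) :=
  oneBig_row_of_cert IndepBlob.oneBigCert_holds a g j x hx hx1 hg hjunk k hbig hkj hsmall hcredit

end RootDec

end Quant
end Summit.CriticalPhenomena.PercolationContinuityZ3.Theorems
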